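import Summits.QuantumFields.BalabanUV.T4Continuum.Support.B13ReadingsAssembly
import Summits.QuantumFields.BalabanUV.T4Continuum.Support.B13StepOfRecord

/-!
# B13ReadingsRecord — row O4-r ∕ leaf L07: W1 OF RECORD ON THE CARRIERS OF RECORD — the background-GENERIC twins of the Bałaban-instance faces
# of `B13ReadingsDecay` ∕ `B13ReadingsDelta` ∕ `B13ReadingsAssembly` (the raw species' background type decoupled from node NE3's datum type) and
# THE RECORD FACE: the `hwer` binder of `B13StepEndInsOp.ne5_of_record_insOp S E₀ cB`, for slots `S` over `B13Carriers.TwoRuns.carriers R`,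
# discharged from `NE3Shape` + class ∕ threshold + O1 letters — no chart, no identification line beyond «the slots hold the species kernels»

Cell `pub-balaban`, unit `b2b-balaban-t4-ne5-p1` (row NE5 OWNER, gen 35; owner item «g35-a» = ruling R50 on the located typing finding
F-ne5leaf04g8-1 of `b2b-balaban-t4-ne5-formalise-leaf-04` gen 8, XREAD X1 of p222372, `HOME/CLAIMS.log` l.15930 ∕ l.15947; the twins of §1 and the K-test
of §2 are that reader's probe `ProbeB13ReadingsAssemblyX1.lean` §P2 ∕ §P3, adopted with credit).  Summits-side NEW WORK under the LEAN PLACEMENT RULE (a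
composition of landed theorems BY NAME; print cited for KIND only).  HONEST FRAMING: rung (B)+1 of the FINITE-VOLUME T⁴ continuum programme — NOT infinite
volume, NOT a mass gap, NOT the Clay problem, NOT a proof of NE5 (NOT PRINTED: the series prints ε-UNIFORM bounds, never η-RATES; GAPS G-t4-U3-1), NOT a proof
of NE2 or NE3.  HONEST DEPENDENCY (cell, verbatim): continuum YM on T⁴ ⇐ BetaPertH ∧ nine spine estimates (0/9 proved); BetaPertH ⇐ (D1) ∧ (D4) ∧ CAP+tail;
G-an2-4 gates asym, D1 and NE2/3/4.

WHY.  The landed faces `B13ReadingsDecay.cov_entryBound_balaban_rate` (p219966 §3), `B13ReadingsDelta.{deltaKer,gammaConstituent}_entryBound_balaban_rate`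
(p221950 §2) and `B13ReadingsAssembly.{speciesEntryBound,weightedEntrywiseRate}_balaban_ne3Shape` (p222372 §2) share ONE type variable `Bg` between node NE3's
admissible data `dom : Set Bg` and the background argument of the raw species `rawA rawB : (ℕ → ℝ) → Bg → ℕ → RawSpecies …`.  On the carriers OF RECORD
(`TwoRuns.carriers R`: `BgB = ↥R.admB ⊆ GaugeField …`) the `hwer` binder of `B13StepEndInsOp.ne5_of_record_insOp` quantifies `U : R.carriers.BgB`, which is
NOT NE3's datum type `Site d → Fin d → (Matrix o o ℂ)ˣ` — so the landed face cannot be fed there IN TYPE (leaf-04's mutant: «Type mismatch»).  The tie is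
UNFORCED: the only link between a background and an NE3 datum is the displayed READING MAP `tow : ℕ → (ℕ → ℝ) → Bg' → ↥dom` («which admissible datum of
node NE3's carrier drives this background at this step») — no chart `π : BgB → …`, no identification line, no `comap`.

WHAT (bookkeeping; no estimate on Bałaban's objects; 0 `def`).  §1 the BACKGROUND-GENERIC TWINS `speciesEntryBound_balaban_ne3Shape'` ∕
`weightedEntrywiseRate_balaban_ne3Shape'` (`{Bg' : Type*}` free for `tow ∕ rawA ∕ rawB ∕ U`; the three species-level conjuncts inlined; proof terms IDENTICAL to the
landed ones — the generic faces `cov∕deltaKer∕gammaConstituent_entryBound_of_twoLevelDecayRate`, `balaban_twoLevelDecayRate_rate`,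
`balaban_image_twoLevelDecayRate_rate`, `potQ∕potR_entryBound_of_ne3Shape`, `speciesEntryBound_of_rates`, `weightedEntrywiseRate_of_entryBound` BY NAME); the landed
statements are the twins at `Bg' := Bg`.  §2 **`weightedEntrywiseRate_record_balaban_ne3Shape`** — THE RECORD FACE: for ANY pair of runs `R : TwoRuns 𝔾` and ANY
slots `S : B13StepOfRecord.Slots R (Species T κ ι Ω 𝒴) IOp Hist` whose raw suppliers ARE the kernels of raw species (`hSA : S.rawA g V k = (rawA₀ g V k).kernel`,
`hSB : S.rawB g U k = (rawB₀ g U k).kernel` — the shape of substrate O-8 `slotsOfRecord`, where both are `rfl`), with run A's readings stated for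
`rawA₀ ∘ R.carriers.transport` (= `Assembly.rawAt`, RULE R4) and the reading map `tow : ℕ → (ℕ → ℝ) → R.carriers.BgB → ↥dom`: NE3 `NE3Shape (minActReadings …) C θ`
(OPEN, row NE3) ∧ (3.35)-class ∧ threshold ∧ the O1 letters (decay `hdec`∕`hdecΦ`∕`hdecΨ`, op-Lipschitz readings `hΦ`∕`hΨ` with `hS₂`∕`hS₃`, tower readings
`ReadsTowerCov∕Delta∕GammaA∕B`, dominations, `PotQ∕PotRLipschitzReading`) ⟹
`WeightedEntrywiseRate S.F (assembly S).rawAt S.rawB W c (k ↦ √(max θ L⁻¹)^k)` — LITERALLY the `hwer` binder of `B13StepEndInsOp.ne5_of_record_insOp S E₀ cB`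
(§2's closing `example` checks by `rfl` that the assembly's `rawAt ∕ rawB ∕ F` are the slots' suppliers, so §2's conclusion is that
binder's type on the nose; the literal feed into `ne5_of_record_insOp` is the X-reader's kernel probe — this module keeps the lighter import cone).  Consumers: the E1-insOp END at Bałaban's background
(`b2b-balaban-t4-ne5-formalise-leaf-10`'s `B13StepEndInsOpBalaban`, owner ruling R50: twin road) and the substrate's O1-letter instance at `slotsOfRecord` (p1 item 3).
HONEST: model level (no B0); which `Φ_t`∕`Ψ_t` realise Bałaban's `A`∕`L` of (2.14) on the member, and the tables `dk`∕`gc`∕`pQ`∕`pR`, are the substrate's O-8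
dictionary — asserted by nobody; NE5 ∕ NE2 ∕ NE3 NOT proved; 0∕12 leaves on Bałaban's concrete objects; spine 0∕9.  `FlowStep.BetaPertH`, (B), (B^μ) do not occur.
ABSOLUTE RULE kept; 0 `def`; 0 sorry; axioms ⊆ {propext, Classical.choice, Quot.sound}.
-/

noncomputable section

open scoped BigOperators ComplexConjugate Matrix Matrix.Norms.L2Operator Kronecker

namespace Summit.QuantumFields.BalabanUV.T4Continuum.B13ReadingsRecord

open Summit.QuantumFields.BalabanUV.T4Continuum
open Summit.QuantumFields.BalabanUV.T4Continuum.B13OpDatum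
open Summit.QuantumFields.BalabanUV.T4Continuum.B13OpDatumJunctions (WeightedEntrywiseRate)
open Summit.QuantumFields.BalabanUV.T4Continuum.B13Readings (SpeciesEntryBound weightedEntrywiseRate_of_entryBound)
open Summit.QuantumFields.BalabanUV.T4Continuum.B13ReadingsDecay (ReadsTowerCovA ReadsTowerCovB CovWeightDominatesDist
  cov_entryBound_of_twoLevelDecayRate balaban_twoLevelDecayRate_rate)
open Summit.QuantumFields.BalabanUV.T4Continuum.B13ReadingsImage
open Summit.QuantumFields.BalabanUV.T4Continuum.B13ReadingsDelta (balaban_image_twoLevelDecayRate_rate)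
open Summit.QuantumFields.BalabanUV.T4Continuum.B13ReadingsLocal (PotQLipschitzReading PotRLipschitzReading
  potQ_entryBound_of_ne3Shape potR_entryBound_of_ne3Shape speciesEntryBound_of_rates)
open Summit.QuantumFields.BalabanUV.T4Continuum.B13ReadingsAssembly (CpertRec)
open Summit.QuantumFields.BalabanUV.T4Continuum.DecayRateInterpolation (EntryDecay)
open Summit.QuantumFields.BalabanUV.T4Continuum.CoerciveInverseTower (Coercive)
open Summit.QuantumFields.BalabanUV.T4Continuum.B13Represents (Assembly)
open Summit.QuantumFields.BalabanUV.T4Continuum.B13StepOfRecord (Slots assembly)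
open Summit.QuantumFields.BalabanUV.T4Continuum.B13Carriers (TwoRuns)
open Summit.QuantumFields.BalabanUV.T4Continuum.B13HistInsertion (InsDatum)
open Literature.MathematicalPhysics.QuantumFieldTheory.Balaban1983to89
open Literature.MathematicalPhysics.QuantumFieldTheory.Balaban1983to89.B5Prop11Plancherel (Cst Cst_nonneg Tor fine)
open Literature.MathematicalPhysics.QuantumFieldTheory.Balaban1983to89.B5G183RateUnitTower (lev lev_neZero)
open Literature.MathematicalPhysics.QuantumFieldTheory.Balaban1983to89.T4EtaRateMin (LocalRate NE3Shape)
open Summit.QuantumFields.BalabanUV.T4Continuum.BalabanAveragedTowerUnit (idx Qlev)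
open Summit.QuantumFields.BalabanUV.T4Continuum.BackgroundResolventTower
open Summit.QuantumFields.BalabanUV.T4Continuum.KingPairingPlantedLaw (calDalev JpcT CJ CJ_nonneg)
open Summit.QuantumFields.BalabanUV.T4Continuum.GramPerturbationLaw (C2gram)
open Summit.QuantumFields.BalabanUV.T4Continuum.NE2FromNE3 (bgReadings)
open Summit.QuantumFields.BalabanUV.T4Continuum.NE2ColourPerturbedLayer (pertCovC)
open Summit.QuantumFields.BalabanUV.T4Continuum.RegularBackgroundTower (RegularTransporters regClass betaNE3)
open Summit.QuantumFields.BalabanUV.T4Continuum.GaugeTermScalarData (QuT Q1)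
open Summit.QuantumFields.BalabanUV.T4Continuum.RegularSiteTransporters (siteT)
open Summit.QuantumFields.BalabanUV.T4Continuum.NestedContourTransport (theta0)
open Summit.QuantumFields.BalabanUV.T4Continuum.NE2BalabanRoot (balabanPert)
open Summit.QuantumFields.BalabanUV.T4Continuum.NE2BalabanGauge (gaugeSlot liftR)
open Summit.QuantumFields.BalabanUV.T4Continuum.NE2BalabanLayerSharp (kappaBs C2Bs KstarR)
open Summit.QuantumFields.BalabanUV.T4Continuum.NE2BalabanWiring (epsR CdeltaR epsR_nonneg)
open Summit.QuantumFields.BalabanUV.T4Continuum.NE2BalabanFinal (tauR kappa4F C4F)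
open Summit.QuantumFields.BalabanUV.T4Continuum.NE2BalabanThreshold (etaStar smallness_of_le)
open Summit.QuantumFields.BalabanUV.T4Continuum.NE2FromNE3Carrier (ne2Loc)
open Summit.QuantumFields.BalabanUV.T4Continuum.NE2BalabanFromNE3 (localRate_minActReadings_iff)
open Summit.QuantumFields.BalabanUV.T4Continuum.MinimalActionRate (minActReadings)

/-! ## §1 The background-generic twins (the raw species' background type decoupled from node NE3's datum type) -/

section Generic

variable {d : ℕ} (L : ℕ) [NeZero L] (M : Fin d → ℕ) [hM : ∀ μ, NeZero (M μ)] (a : ℝ) (ha : 0 < a)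
variable {o : Type*} [Fintype o] [DecidableEq o] {α β C a' η : ℝ} {Bg Bg' : Type*}
variable {T κ ι Ω 𝒴 m : Type*} [Fintype m] [DecidableEq m]

/-- [folklore] **Background-generic twin of `B13ReadingsAssembly.speciesEntryBound_balaban_ne3Shape`** (p222372 §2): the datum type of `dom` is node NE3's
(`minActReadings`); the background type `Bg'` of `tow ∕ rawA ∕ rawB ∕ U` is FREE.  The five species conjuncts at Bałaban's tier-B member of record assembled at
the slowest rate `√(max θ L⁻¹)` into ONE `SpeciesEntryBound` — script identical to the landed one, with the primed conjuncts. -/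
theorem speciesEntryBound_balaban_ne3Shape' {𝒞 : ℕ → Set (B7Prop1Explicit.Site d → Fin d → (Matrix o o ℂ)ˣ)} {N : ℕ}
    {dom : Set (B7Prop1Explicit.Site d → Fin d → (Matrix o o ℂ)ˣ)} (hL : 2 ≤ L) (hd : 1 ≤ d)
    {RgV : (B7Prop1Explicit.Site d → Fin d → (Matrix o o ℂ)ˣ) → ((k : ℕ) → Fin d → (Tor (fine (lev L k) M) → Matrix o o ℂ))}
    (hreg : ∀ V ∈ dom, RegularTransporters L M (liftR L M (RgV V)) α β) (hα : 0 ≤ α) (hβ : 0 ≤ β) (hC : 0 ≤ C) {θ : ℝ}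
    (hNE3 : NE3Shape (minActReadings d 𝒞 L N dom (ne2Loc L M fun V => liftR L M (RgV V))) C θ)
    (ha' : 0 < a') (hαη : α ≤ η) (hβη : β ≤ η) (hη : η ≤ etaStar o d a a')
    {Fk : ℕ → Format (Species T κ ι Ω 𝒴)} {tow : ℕ → (ℕ → ℝ) → Bg' → ↥dom}
    {rawA rawB : (ℕ → ℝ) → Bg' → ℕ → RawSpecies T κ ι Ω 𝒴} {W : Set (ℕ → ℝ)}
    {σ : T → κ → idx L M 0 × o} {dist₁ : idx L M 0 × o → idx L M 0 × o → ℝ} {B₁ δ₁ : ℝ}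
    (hdec : ∀ V ∈ dom, ∀ k, EntryDecay dist₁
      (pertCovC L M a ha (balabanPert L M a (liftR L M (RgV V)) (gaugeSlot L M (RgV V) (QuT L M o (siteT L M (RgV V))) (Q1 L M o) a'))
        1 k) B₁ δ₁)
    (hcovA : ReadsTowerCovA
      (fun V : ↥dom => pertCovC L M a ha
        (balabanPert L M a (liftR L M (RgV V)) (gaugeSlot L M (RgV V) (QuT L M o (siteT L M (RgV V))) (Q1 L M o) a')) 1)
      σ tow rawA W)
    (hcovB : ReadsTowerCovB
      (fun V : ↥dom => pertCovC L M a ha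
        (balabanPert L M a (liftR L M (RgV V)) (gaugeSlot L M (RgV V) (QuT L M o (siteT L M (RgV V))) (Q1 L M o) a')) 1)
      σ tow rawB W)
    (hdom₁ : CovWeightDominatesDist Fk dist₁ σ (δ₁ / 2))
    {S₂ : Set (Matrix (idx L M 0 × o) (idx L M 0 × o) ℂ)} {Φ : T → Matrix (idx L M 0 × o) (idx L M 0 × o) ℂ → Matrix m m ℂ}
    {Λ₂ : ℝ} (hΦ : ∀ t, OpLipschitzOn S₂ (Φ t) Λ₂) (hΛ₂ : 0 ≤ Λ₂)
    (hS₂ : ∀ V ∈ dom, ∀ k, pertCovC L M a ha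
      (balabanPert L M a (liftR L M (RgV V)) (gaugeSlot L M (RgV V) (QuT L M o (siteT L M (RgV V))) (Q1 L M o) a')) 1 k ∈ S₂)
    {dist₂ : m → m → ℝ} {B₂ δ₂ : ℝ}
    (hdecΦ : ∀ V ∈ dom, ∀ t k, EntryDecay dist₂ (Φ t (pertCovC L M a ha
      (balabanPert L M a (liftR L M (RgV V)) (gaugeSlot L M (RgV V) (QuT L M o (siteT L M (RgV V))) (Q1 L M o) a')) 1 k)) B₂ δ₂)
    {σX : T → ι → m}
    (hΔA : ReadsTowerDeltaA (fun (V : ↥dom) t k => Φ t (pertCovC L M a ha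
      (balabanPert L M a (liftR L M (RgV V)) (gaugeSlot L M (RgV V) (QuT L M o (siteT L M (RgV V))) (Q1 L M o) a')) 1 k))
      σX tow rawA W)
    (hΔB : ReadsTowerDeltaB (fun (V : ↥dom) t k => Φ t (pertCovC L M a ha
      (balabanPert L M a (liftR L M (RgV V)) (gaugeSlot L M (RgV V) (QuT L M o (siteT L M (RgV V))) (Q1 L M o) a')) 1 k))
      σX tow rawB W)
    (hdom₂ : DeltaWeightDominatesDist Fk dist₂ σX (δ₂ / 2))
    {S₃ : Set (Matrix (idx L M 0 × o) (idx L M 0 × o) ℂ)} {Ψ : T → Matrix (idx L M 0 × o) (idx L M 0 × o) ℂ → Matrix m m ℂ}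
    {Λ₃ : ℝ} (hΨ : ∀ t, OpLipschitzOn S₃ (Ψ t) Λ₃) (hΛ₃ : 0 ≤ Λ₃)
    (hS₃ : ∀ V ∈ dom, ∀ k, pertCovC L M a ha
      (balabanPert L M a (liftR L M (RgV V)) (gaugeSlot L M (RgV V) (QuT L M o (siteT L M (RgV V))) (Q1 L M o) a')) 1 k ∈ S₃)
    {dist₃ : m → m → ℝ} {B₃ δ₃ : ℝ}
    (hdecΨ : ∀ V ∈ dom, ∀ t k, EntryDecay dist₃ (Ψ t (pertCovC L M a ha
      (balabanPert L M a (liftR L M (RgV V)) (gaugeSlot L M (RgV V) (QuT L M o (siteT L M (RgV V))) (Q1 L M o) a')) 1 k)) B₃ δ₃)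
    {σB : T → κ → m}
    (hΓA : ReadsTowerGammaA (fun (V : ↥dom) t k => Ψ t (pertCovC L M a ha
      (balabanPert L M a (liftR L M (RgV V)) (gaugeSlot L M (RgV V) (QuT L M o (siteT L M (RgV V))) (Q1 L M o) a')) 1 k))
      σB σX tow rawA W)
    (hΓB : ReadsTowerGammaB (fun (V : ↥dom) t k => Ψ t (pertCovC L M a ha
      (balabanPert L M a (liftR L M (RgV V)) (gaugeSlot L M (RgV V) (QuT L M o (siteT L M (RgV V))) (Q1 L M o) a')) 1 k))
      σB σX tow rawB W)
    (hdom₃ : GammaWeightDominatesDist Fk dist₃ σB σX (δ₃ / 2))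
    {Λ₄ Λ₅ : ℝ} (hΛ₄ : 0 ≤ Λ₄) (hΛ₅ : 0 ≤ Λ₅)
    (hQ : PotQLipschitzReading (minActReadings d 𝒞 L N dom (ne2Loc L M fun V => liftR L M (RgV V))) Fk rawA rawB W Λ₄)
    (hR : PotRLipschitzReading (minActReadings d 𝒞 L N dom (ne2Loc L M fun V => liftR L M (RgV V))) Fk rawA rawB W Λ₅)
    (k : ℕ) {g : ℕ → ℝ} (hg : g ∈ W) (U : Bg') :
    SpeciesEntryBound (Fk k) (rawA g U k) (rawB g U k)
      ((Real.sqrt (2 * B₁ * (2 * CpertRec o d L a α β C a' / (1 - max θ ((L : ℝ)⁻¹)))) +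
          Real.sqrt (2 * B₂ * (Λ₂ * CpertRec o d L a α β C a')) +
          Real.sqrt (2 * B₃ * (Λ₃ * CpertRec o d L a α β C a')) +
          Λ₄ * C + Λ₅ * C) * Real.sqrt (max θ ((L : ℝ)⁻¹)) ^ k) := by
  have hL1 : (1 : ℝ) < L := by exact_mod_cast (lt_of_lt_of_le one_lt_two hL : 1 < L)
  have hlt : max θ ((L : ℝ)⁻¹) < 1 := max_lt hNE3.rate_lt_one (inv_lt_one_of_one_lt₀ hL1)
  have hρ0 : 0 ≤ max θ ((L : ℝ)⁻¹) := hNE3.rate_nonneg.trans (le_max_left _ _)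
  have hloc : ∀ V ∈ dom, LocalRate (bgReadings L M (regClass L M (liftR L M (RgV V)))) C (max θ ((L : ℝ)⁻¹)) := fun V hV =>
    ((localRate_minActReadings_iff L M).1 hNE3.pointwise V hV).mono le_rfl hNE3.rate_nonneg (le_max_left _ _) hC
  have hθΘ : θ ≤ Real.sqrt (max θ ((L : ℝ)⁻¹)) := by
    have hs : Real.sqrt (max θ ((L : ℝ)⁻¹)) ≤ 1 := by
      rw [show (1 : ℝ) = Real.sqrt 1 from Real.sqrt_one.symm]
      exact Real.sqrt_le_sqrt hlt.le
    calc θ ≤ max θ ((L : ℝ)⁻¹) := le_max_left _ _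
      _ = Real.sqrt (max θ ((L : ℝ)⁻¹)) * Real.sqrt (max θ ((L : ℝ)⁻¹)) := (Real.mul_self_sqrt hρ0).symm
      _ ≤ Real.sqrt (max θ ((L : ℝ)⁻¹)) * 1 := mul_le_mul_of_nonneg_left hs (Real.sqrt_nonneg _)
      _ = Real.sqrt (max θ ((L : ℝ)⁻¹)) := mul_one _
  have hΛC₄ : 0 ≤ Λ₄ * C := mul_nonneg hΛ₄ hC
  have hΛC₅ : 0 ≤ Λ₅ * C := mul_nonneg hΛ₅ hC
  unfold CpertRec
  refine speciesEntryBound_of_rates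
    (fun t a'' a''' => cov_entryBound_of_twoLevelDecayRate (Real.sqrt_nonneg _) (Real.sqrt_nonneg _)
      (fun V : ↥dom => balaban_twoLevelDecayRate_rate L M a ha hd (hreg V.1 V.2) hα hβ hC (le_max_right _ _) hlt (hloc V.1 V.2) ha' hαη
        hβη hη (hdec V.1 V.2)) hcovA hcovB hdom₁ k hg U t a'' a''')
    (fun t i j => deltaKer_entryBound_of_twoLevelDecayRate (Real.sqrt_nonneg _) (Real.sqrt_nonneg _)
      (fun (V : ↥dom) t => balaban_image_twoLevelDecayRate_rate L M a ha hd hreg hα hβ hC (le_max_right _ _) hlt hloc ha' hαη hβη hη hΦ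
        hΛ₂ hS₂ hdecΦ V.1 V.2 t) hΔA hΔB hdom₂ k hg U t i j)
    (fun t a'' i => gammaConstituent_entryBound_of_twoLevelDecayRate (Real.sqrt_nonneg _) (Real.sqrt_nonneg _)
      (fun (V : ↥dom) t => balaban_image_twoLevelDecayRate_rate L M a ha hd hreg hα hβ hC (le_max_right _ _) hlt hloc ha' hαη hβη hη hΨ
        hΛ₃ hS₃ hdecΨ V.1 V.2 t) hΓA hΓB hdom₃ k hg U t a'' i)
    (fun x Y b b' => potQ_entryBound_of_ne3Shape hΛ₄ hNE3 hQ k hg U x Y b b')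
    (fun x Y => potR_entryBound_of_ne3Shape hΛ₅ hNE3 hR k hg U x Y)
    (Real.sqrt_nonneg _) (Real.sqrt_nonneg _) (Real.sqrt_nonneg _) hΛC₄ hΛC₅ ?_ ?_ ?_ ?_ ?_
    (Real.sqrt_nonneg _) (Real.sqrt_nonneg _) (Real.sqrt_nonneg _) hNE3.rate_nonneg hNE3.rate_nonneg le_rfl le_rfl le_rfl hθΘ hθΘ
  all_goals
    linarith [Real.sqrt_nonneg (2 * B₁ * (2 *
        Cpert (kappaBs o d a α β (a * (epsR o d α * (2 + epsR o d α) * Cst d a)) (kappa4F d a a' α β)) (2 * d * Cst d a) (CJ d a)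
          (C2Bs o d L a α β C
            (a * C2gram (Cst d a) 1 (epsR o d α) (2 * d * Cst d a) (CJ d a) (Cst d a) (CdeltaR o d a α (theta0 d α (betaNE3 o C))))
            (C4F o d L a a' α β C)) 0 1 / (1 - max θ ((L : ℝ)⁻¹)))),
      Real.sqrt_nonneg (2 * B₂ * (Λ₂ *
        Cpert (kappaBs o d a α β (a * (epsR o d α * (2 + epsR o d α) * Cst d a)) (kappa4F d a a' α β)) (2 * d * Cst d a) (CJ d a)
          (C2Bs o d L a α β C
            (a * C2gram (Cst d a) 1 (epsR o d α) (2 * d * Cst d a) (CJ d a) (Cst d a) (CdeltaR o d a α (theta0 d α (betaNE3 o C))))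
            (C4F o d L a a' α β C)) 0 1)),
      Real.sqrt_nonneg (2 * B₃ * (Λ₃ *
        Cpert (kappaBs o d a α β (a * (epsR o d α * (2 + epsR o d α) * Cst d a)) (kappa4F d a a' α β)) (2 * d * Cst d a) (CJ d a)
          (C2Bs o d L a α β C
            (a * C2gram (Cst d a) 1 (epsR o d α) (2 * d * Cst d a) (CJ d a) (Cst d a) (CdeltaR o d a α (theta0 d α (betaNE3 o C))))
            (C4F o d L a a' α β C)) 0 1))]

/-- [folklore] **Background-generic twin of `B13ReadingsAssembly.weightedEntrywiseRate_balaban_ne3Shape`** (p222372 §2): the END-of-record W1 binder shape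
`WeightedEntrywiseRate Fk (kernel ∘ rawA) (kernel ∘ rawB) W c (k ↦ √(max θ L⁻¹)^k)` over ANY background type `Bg'`, displaying ONLY node U1b's `NE3Shape`
(OPEN, row NE3) + the (3.35)-class ∕ threshold + the O1 instance's reading ∕ decay ∕ Lipschitz letters. -/
theorem weightedEntrywiseRate_balaban_ne3Shape' {𝒞 : ℕ → Set (B7Prop1Explicit.Site d → Fin d → (Matrix o o ℂ)ˣ)} {N : ℕ}
    {dom : Set (B7Prop1Explicit.Site d → Fin d → (Matrix o o ℂ)ˣ)} (hL : 2 ≤ L) (hd : 1 ≤ d)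
    {RgV : (B7Prop1Explicit.Site d → Fin d → (Matrix o o ℂ)ˣ) → ((k : ℕ) → Fin d → (Tor (fine (lev L k) M) → Matrix o o ℂ))}
    (hreg : ∀ V ∈ dom, RegularTransporters L M (liftR L M (RgV V)) α β) (hα : 0 ≤ α) (hβ : 0 ≤ β) (hC : 0 ≤ C) {θ : ℝ}
    (hNE3 : NE3Shape (minActReadings d 𝒞 L N dom (ne2Loc L M fun V => liftR L M (RgV V))) C θ)
    (ha' : 0 < a') (hαη : α ≤ η) (hβη : β ≤ η) (hη : η ≤ etaStar o d a a')
    {Fk : ℕ → Format (Species T κ ι Ω 𝒴)} {tow : ℕ → (ℕ → ℝ) → Bg' → ↥dom}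
    {rawA rawB : (ℕ → ℝ) → Bg' → ℕ → RawSpecies T κ ι Ω 𝒴} {W : Set (ℕ → ℝ)}
    {σ : T → κ → idx L M 0 × o} {dist₁ : idx L M 0 × o → idx L M 0 × o → ℝ} {B₁ δ₁ : ℝ}
    (hdec : ∀ V ∈ dom, ∀ k, EntryDecay dist₁
      (pertCovC L M a ha (balabanPert L M a (liftR L M (RgV V)) (gaugeSlot L M (RgV V) (QuT L M o (siteT L M (RgV V))) (Q1 L M o) a'))
        1 k) B₁ δ₁)
    (hcovA : ReadsTowerCovA
      (fun V : ↥dom => pertCovC L M a ha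
        (balabanPert L M a (liftR L M (RgV V)) (gaugeSlot L M (RgV V) (QuT L M o (siteT L M (RgV V))) (Q1 L M o) a')) 1)
      σ tow rawA W)
    (hcovB : ReadsTowerCovB
      (fun V : ↥dom => pertCovC L M a ha
        (balabanPert L M a (liftR L M (RgV V)) (gaugeSlot L M (RgV V) (QuT L M o (siteT L M (RgV V))) (Q1 L M o) a')) 1)
      σ tow rawB W)
    (hdom₁ : CovWeightDominatesDist Fk dist₁ σ (δ₁ / 2))
    {S₂ : Set (Matrix (idx L M 0 × o) (idx L M 0 × o) ℂ)} {Φ : T → Matrix (idx L M 0 × o) (idx L M 0 × o) ℂ → Matrix m m ℂ}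
    {Λ₂ : ℝ} (hΦ : ∀ t, OpLipschitzOn S₂ (Φ t) Λ₂) (hΛ₂ : 0 ≤ Λ₂)
    (hS₂ : ∀ V ∈ dom, ∀ k, pertCovC L M a ha
      (balabanPert L M a (liftR L M (RgV V)) (gaugeSlot L M (RgV V) (QuT L M o (siteT L M (RgV V))) (Q1 L M o) a')) 1 k ∈ S₂)
    {dist₂ : m → m → ℝ} {B₂ δ₂ : ℝ}
    (hdecΦ : ∀ V ∈ dom, ∀ t k, EntryDecay dist₂ (Φ t (pertCovC L M a ha
      (balabanPert L M a (liftR L M (RgV V)) (gaugeSlot L M (RgV V) (QuT L M o (siteT L M (RgV V))) (Q1 L M o) a')) 1 k)) B₂ δ₂)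
    {σX : T → ι → m}
    (hΔA : ReadsTowerDeltaA (fun (V : ↥dom) t k => Φ t (pertCovC L M a ha
      (balabanPert L M a (liftR L M (RgV V)) (gaugeSlot L M (RgV V) (QuT L M o (siteT L M (RgV V))) (Q1 L M o) a')) 1 k))
      σX tow rawA W)
    (hΔB : ReadsTowerDeltaB (fun (V : ↥dom) t k => Φ t (pertCovC L M a ha
      (balabanPert L M a (liftR L M (RgV V)) (gaugeSlot L M (RgV V) (QuT L M o (siteT L M (RgV V))) (Q1 L M o) a')) 1 k))
      σX tow rawB W)
    (hdom₂ : DeltaWeightDominatesDist Fk dist₂ σX (δ₂ / 2))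
    {S₃ : Set (Matrix (idx L M 0 × o) (idx L M 0 × o) ℂ)} {Ψ : T → Matrix (idx L M 0 × o) (idx L M 0 × o) ℂ → Matrix m m ℂ}
    {Λ₃ : ℝ} (hΨ : ∀ t, OpLipschitzOn S₃ (Ψ t) Λ₃) (hΛ₃ : 0 ≤ Λ₃)
    (hS₃ : ∀ V ∈ dom, ∀ k, pertCovC L M a ha
      (balabanPert L M a (liftR L M (RgV V)) (gaugeSlot L M (RgV V) (QuT L M o (siteT L M (RgV V))) (Q1 L M o) a')) 1 k ∈ S₃)
    {dist₃ : m → m → ℝ} {B₃ δ₃ : ℝ}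
    (hdecΨ : ∀ V ∈ dom, ∀ t k, EntryDecay dist₃ (Ψ t (pertCovC L M a ha
      (balabanPert L M a (liftR L M (RgV V)) (gaugeSlot L M (RgV V) (QuT L M o (siteT L M (RgV V))) (Q1 L M o) a')) 1 k)) B₃ δ₃)
    {σB : T → κ → m}
    (hΓA : ReadsTowerGammaA (fun (V : ↥dom) t k => Ψ t (pertCovC L M a ha
      (balabanPert L M a (liftR L M (RgV V)) (gaugeSlot L M (RgV V) (QuT L M o (siteT L M (RgV V))) (Q1 L M o) a')) 1 k))
      σB σX tow rawA W)
    (hΓB : ReadsTowerGammaB (fun (V : ↥dom) t k => Ψ t (pertCovC L M a ha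
      (balabanPert L M a (liftR L M (RgV V)) (gaugeSlot L M (RgV V) (QuT L M o (siteT L M (RgV V))) (Q1 L M o) a')) 1 k))
      σB σX tow rawB W)
    (hdom₃ : GammaWeightDominatesDist Fk dist₃ σB σX (δ₃ / 2))
    {Λ₄ Λ₅ : ℝ} (hΛ₄ : 0 ≤ Λ₄) (hΛ₅ : 0 ≤ Λ₅)
    (hQ : PotQLipschitzReading (minActReadings d 𝒞 L N dom (ne2Loc L M fun V => liftR L M (RgV V))) Fk rawA rawB W Λ₄)
    (hR : PotRLipschitzReading (minActReadings d 𝒞 L N dom (ne2Loc L M fun V => liftR L M (RgV V))) Fk rawA rawB W Λ₅) :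
    WeightedEntrywiseRate Fk (fun g U k => (rawA g U k).kernel) (fun g U k => (rawB g U k).kernel) W
      (Real.sqrt (2 * B₁ * (2 * CpertRec o d L a α β C a' / (1 - max θ ((L : ℝ)⁻¹)))) +
          Real.sqrt (2 * B₂ * (Λ₂ * CpertRec o d L a α β C a')) +
          Real.sqrt (2 * B₃ * (Λ₃ * CpertRec o d L a α β C a')) +
          Λ₄ * C + Λ₅ * C)
      (fun k => Real.sqrt (max θ ((L : ℝ)⁻¹)) ^ k) :=
  weightedEntrywiseRate_of_entryBound fun k _ hg U =>
    speciesEntryBound_balaban_ne3Shape' L M a ha hL hd hreg hα hβ hC hNE3 ha' hαη hβη hη hdec hcovA hcovB hdom₁ hΦ hΛ₂ hS₂ hdecΦ hΔA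
      hΔB hdom₂ hΨ hΛ₃ hS₃ hdecΨ hΓA hΓB hdom₃ hΛ₄ hΛ₅ hQ hR k hg U

end Generic

/-! ## §2 The record face: the `hwer` binder of `B13StepEndInsOp.ne5_of_record_insOp` on `TwoRuns.carriers` -/

section Record

variable {G : Type} [GaugeGroup G] {R : TwoRuns G}
variable {d : ℕ} (L : ℕ) [NeZero L] (M : Fin d → ℕ) [hM : ∀ μ, NeZero (M μ)] (a : ℝ) (ha : 0 < a)
variable {o : Type*} [Fintype o] [DecidableEq o] {α β C a' η : ℝ}
variable {T κ ι Ω 𝒴 m : Type*} [Fintype m] [DecidableEq m]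
variable {IOp Hist : Type*} [NormedAddCommGroup Hist] [NormedSpace ℂ Hist]

/-- [folklore] **THE RECORD FACE — W1 OF RECORD ON THE CARRIERS OF RECORD.**  For ANY pair of runs `R` and ANY slots `S` over `R.carriers` whose raw
suppliers are the KERNELS of raw species (`hSA`, `hSB` — `rfl` at substrate O-8 `slotsOfRecord`), run A's species read at run-A backgrounds and fed at the
TRANSPORTED background (RULE R4: `(assembly S).rawAt g U k = S.rawA g (R.carriers.transport U) k`, `rfl`), and a reading map
`tow : ℕ → (ℕ → ℝ) → R.carriers.BgB → ↥dom` into node NE3's admissible data: `NE3Shape (minActReadings …) C θ` (OPEN, row NE3) ∧ the (3.35)-class ∧ the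
threshold ∧ the O1 instance's decay ∕ op-Lipschitz ∕ tower-reading ∕ domination ∕ potential-Lipschitz LETTERS ⟹ the `hwer` binder of
`B13StepEndInsOp.ne5_of_record_insOp S E₀ cB` at `c₁ = √(2B₁·2CpertRec∕(1−ρ′)) + √(2B₂·Λ₂·CpertRec) + √(2B₃·Λ₃·CpertRec) + Λ₄C + Λ₅C`, `θ := √ρ′`,
`ρ′ = max θ_NE3 L⁻¹` — by ONE application of §1's `weightedEntrywiseRate_balaban_ne3Shape'` at `Bg' := R.carriers.BgB`.  No chart, no `comap`, no identification
line beyond `hSA`∕`hSB`.  (K-test of leaf-04 gen 8, probe §P3, as a theorem.) -/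
theorem weightedEntrywiseRate_record_balaban_ne3Shape (S : Slots R (Species T κ ι Ω 𝒴) IOp Hist)
    {rawA₀ : (ℕ → ℝ) → R.carriers.BgA → ℕ → RawSpecies T κ ι Ω 𝒴} {rawB₀ : (ℕ → ℝ) → R.carriers.BgB → ℕ → RawSpecies T κ ι Ω 𝒴}
    (hSA : ∀ g V k, S.rawA g V k = (rawA₀ g V k).kernel) (hSB : ∀ g U k, S.rawB g U k = (rawB₀ g U k).kernel)
    {𝒞 : ℕ → Set (B7Prop1Explicit.Site d → Fin d → (Matrix o o ℂ)ˣ)} {N : ℕ}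
    {dom : Set (B7Prop1Explicit.Site d → Fin d → (Matrix o o ℂ)ˣ)} (hL : 2 ≤ L) (hd : 1 ≤ d)
    {RgV : (B7Prop1Explicit.Site d → Fin d → (Matrix o o ℂ)ˣ) → ((k : ℕ) → Fin d → (Tor (fine (lev L k) M) → Matrix o o ℂ))}
    (hreg : ∀ V ∈ dom, RegularTransporters L M (liftR L M (RgV V)) α β) (hα : 0 ≤ α) (hβ : 0 ≤ β) (hC : 0 ≤ C) {θ : ℝ}
    (hNE3 : NE3Shape (minActReadings d 𝒞 L N dom (ne2Loc L M fun V => liftR L M (RgV V))) C θ)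
    (ha' : 0 < a') (hαη : α ≤ η) (hβη : β ≤ η) (hη : η ≤ etaStar o d a a')
    {tow : ℕ → (ℕ → ℝ) → R.carriers.BgB → ↥dom} {W : Set (ℕ → ℝ)}
    {σ : T → κ → idx L M 0 × o} {dist₁ : idx L M 0 × o → idx L M 0 × o → ℝ} {B₁ δ₁ : ℝ}
    (hdec : ∀ V ∈ dom, ∀ k, EntryDecay dist₁
      (pertCovC L M a ha (balabanPert L M a (liftR L M (RgV V)) (gaugeSlot L M (RgV V) (QuT L M o (siteT L M (RgV V))) (Q1 L M o) a'))
        1 k) B₁ δ₁)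
    (hcovA : ReadsTowerCovA
      (fun V : ↥dom => pertCovC L M a ha
        (balabanPert L M a (liftR L M (RgV V)) (gaugeSlot L M (RgV V) (QuT L M o (siteT L M (RgV V))) (Q1 L M o) a')) 1)
      σ tow (fun g U k => rawA₀ g (R.carriers.transport U) k) W)
    (hcovB : ReadsTowerCovB
      (fun V : ↥dom => pertCovC L M a ha
        (balabanPert L M a (liftR L M (RgV V)) (gaugeSlot L M (RgV V) (QuT L M o (siteT L M (RgV V))) (Q1 L M o) a')) 1)
      σ tow rawB₀ W)
    (hdom₁ : CovWeightDominatesDist S.F dist₁ σ (δ₁ / 2))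
    {S₂ : Set (Matrix (idx L M 0 × o) (idx L M 0 × o) ℂ)} {Φ : T → Matrix (idx L M 0 × o) (idx L M 0 × o) ℂ → Matrix m m ℂ}
    {Λ₂ : ℝ} (hΦ : ∀ t, OpLipschitzOn S₂ (Φ t) Λ₂) (hΛ₂ : 0 ≤ Λ₂)
    (hS₂ : ∀ V ∈ dom, ∀ k, pertCovC L M a ha
      (balabanPert L M a (liftR L M (RgV V)) (gaugeSlot L M (RgV V) (QuT L M o (siteT L M (RgV V))) (Q1 L M o) a')) 1 k ∈ S₂)
    {dist₂ : m → m → ℝ} {B₂ δ₂ : ℝ}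
    (hdecΦ : ∀ V ∈ dom, ∀ t k, EntryDecay dist₂ (Φ t (pertCovC L M a ha
      (balabanPert L M a (liftR L M (RgV V)) (gaugeSlot L M (RgV V) (QuT L M o (siteT L M (RgV V))) (Q1 L M o) a')) 1 k)) B₂ δ₂)
    {σX : T → ι → m}
    (hΔA : ReadsTowerDeltaA (fun (V : ↥dom) t k => Φ t (pertCovC L M a ha
      (balabanPert L M a (liftR L M (RgV V)) (gaugeSlot L M (RgV V) (QuT L M o (siteT L M (RgV V))) (Q1 L M o) a')) 1 k))
      σX tow (fun g U k => rawA₀ g (R.carriers.transport U) k) W)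
    (hΔB : ReadsTowerDeltaB (fun (V : ↥dom) t k => Φ t (pertCovC L M a ha
      (balabanPert L M a (liftR L M (RgV V)) (gaugeSlot L M (RgV V) (QuT L M o (siteT L M (RgV V))) (Q1 L M o) a')) 1 k))
      σX tow rawB₀ W)
    (hdom₂ : DeltaWeightDominatesDist S.F dist₂ σX (δ₂ / 2))
    {S₃ : Set (Matrix (idx L M 0 × o) (idx L M 0 × o) ℂ)} {Ψ : T → Matrix (idx L M 0 × o) (idx L M 0 × o) ℂ → Matrix m m ℂ}
    {Λ₃ : ℝ} (hΨ : ∀ t, OpLipschitzOn S₃ (Ψ t) Λ₃) (hΛ₃ : 0 ≤ Λ₃)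
    (hS₃ : ∀ V ∈ dom, ∀ k, pertCovC L M a ha
      (balabanPert L M a (liftR L M (RgV V)) (gaugeSlot L M (RgV V) (QuT L M o (siteT L M (RgV V))) (Q1 L M o) a')) 1 k ∈ S₃)
    {dist₃ : m → m → ℝ} {B₃ δ₃ : ℝ}
    (hdecΨ : ∀ V ∈ dom, ∀ t k, EntryDecay dist₃ (Ψ t (pertCovC L M a ha
      (balabanPert L M a (liftR L M (RgV V)) (gaugeSlot L M (RgV V) (QuT L M o (siteT L M (RgV V))) (Q1 L M o) a')) 1 k)) B₃ δ₃)
    {σB : T → κ → m}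
    (hΓA : ReadsTowerGammaA (fun (V : ↥dom) t k => Ψ t (pertCovC L M a ha
      (balabanPert L M a (liftR L M (RgV V)) (gaugeSlot L M (RgV V) (QuT L M o (siteT L M (RgV V))) (Q1 L M o) a')) 1 k))
      σB σX tow (fun g U k => rawA₀ g (R.carriers.transport U) k) W)
    (hΓB : ReadsTowerGammaB (fun (V : ↥dom) t k => Ψ t (pertCovC L M a ha
      (balabanPert L M a (liftR L M (RgV V)) (gaugeSlot L M (RgV V) (QuT L M o (siteT L M (RgV V))) (Q1 L M o) a')) 1 k))
      σB σX tow rawB₀ W)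
    (hdom₃ : GammaWeightDominatesDist S.F dist₃ σB σX (δ₃ / 2))
    {Λ₄ Λ₅ : ℝ} (hΛ₄ : 0 ≤ Λ₄) (hΛ₅ : 0 ≤ Λ₅)
    (hQ : PotQLipschitzReading (minActReadings d 𝒞 L N dom (ne2Loc L M fun V => liftR L M (RgV V))) S.F
      (fun g U k => rawA₀ g (R.carriers.transport U) k) rawB₀ W Λ₄)
    (hR : PotRLipschitzReading (minActReadings d 𝒞 L N dom (ne2Loc L M fun V => liftR L M (RgV V))) S.F
      (fun g U k => rawA₀ g (R.carriers.transport U) k) rawB₀ W Λ₅) :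
    -- ↓↓ the `hwer` binder of `B13StepEndInsOp.ne5_of_record_insOp S E₀ cB`, verbatim shape ↓↓
    WeightedEntrywiseRate S.F (assembly S).rawAt S.rawB W
      (Real.sqrt (2 * B₁ * (2 * CpertRec o d L a α β C a' / (1 - max θ ((L : ℝ)⁻¹)))) +
          Real.sqrt (2 * B₂ * (Λ₂ * CpertRec o d L a α β C a')) +
          Real.sqrt (2 * B₃ * (Λ₃ * CpertRec o d L a α β C a')) +
          Λ₄ * C + Λ₅ * C)
      (fun k => Real.sqrt (max θ ((L : ℝ)⁻¹)) ^ k) := by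
  intro k g hg U e
  show ‖S.rawA g (R.carriers.transport U) k e - S.rawB g U k e‖ ≤ _
  rw [hSA, hSB]
  exact weightedEntrywiseRate_balaban_ne3Shape' L M a ha hL hd hreg hα hβ hC hNE3 ha' hαη hβη hη hdec hcovA hcovB hdom₁ hΦ hΛ₂ hS₂
    hdecΦ hΔA hΔB hdom₂ hΨ hΛ₃ hS₃ hdecΨ hΓA hΓB hdom₃ hΛ₄ hΛ₅ hQ hR k g hg U e

/-- [folklore] Sanity (all `rfl`): run A's assembled supplier IS run A's slot read at the transported background, and the format of the assembly is the
slots' format — so §2's conclusion is the `hwer` binder type of `B13StepEndInsOp.ne5_of_record_insOp S E₀ cB` on the nose. -/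
example (S : Slots R (Species T κ ι Ω 𝒴) IOp Hist) :
    ((assembly S).rawAt = fun g U k => S.rawA g (R.carriers.transport U) k) ∧ (assembly S).rawB = S.rawB ∧ (assembly S).F = S.F :=
  ⟨rfl, rfl, rfl⟩

end Record

end Summit.QuantumFields.BalabanUV.T4Continuum.B13ReadingsRecord

end
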